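import Summits.AtomisticToContinuum.Crystallization.Theorems.ChartedZeroExcessLayeredLatticeLiouvilleUY

/-!
# Zero-excess layered lattice Liouville — part UZ (lens-2 g57, node «CaccioppoliZ» 2/2): CACCIOPPOLI ON INDEX BALLS — in (LD)'s currency.

`caccioppoli_idxBall` (configuration-free, chart-free): for every `c > 0`, `κ₀ > 0` there is `ϱ_C ≥ 1` such that for all `ϱ ≥ ϱ_C`, every
`κ₀`-coercive `c`-co-Lipschitz layered crystal `(a, b, w)`, every centre `x₀`, radii `r < n`, every `φ` that is `ϱ`-truncated-harmonic on `idxBall x₀ n`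
and every constant `v`,
`κ₀ · idxEnergy φ (idxBall x₀ r) ≤ 54·F(c)·(n − r)⁻² · Σ_{X ∈ idxBall x₀ (n + ϱ/c)} ‖φ_X − v‖²`
— [giaquinta1984 Ch. III (2.2)] for the lattice system, from part UY's `caccioppoliZ_cert` with the piecewise-linear radial cut-off
`ζ_X = max 0 (min 1 ((n − dist X x₀)/(n − r)))` (`= 1` on `idxBall x₀ r`, `= 0` off `idxBall x₀ n`, `(n − r)⁻¹`-Lipschitz) and the inclusion
`nearSet (idxBall x₀ n) ⊆ idxBall x₀ (n + ϱ/c)` (co-Lipschitz).  First brick of (LD) `LinearExcessDecayZ` (Campanato iteration = Caccioppoli +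
compactness / higher-order estimates); nothing of the column is re-typed, nothing here is an item.
-/

noncomputable section

open scoped BigOperators InnerProductSpace RealInnerProductSpace
open MeasureTheory Set Metric Filter Topology
open Summit.AtomisticToContinuum.Crystallization.Theorems.ChartedPlanarOrderRigidityDoor (E3 IsNash atomsIn)
open Summit.AtomisticToContinuum.Crystallization.Theorems.ChartedPlanarOrderDensityDichotomy (μS IsSep nK nK_nonneg)
open Summit.AtomisticToContinuum.Crystallization.Theorems.ChartedPlanarOrderDoorLayered (Layered layeredHom_eq_layered)

namespace Summit.AtomisticToContinuum.Crystallization.Theorems.ChartedZeroExcessLayeredLatticeLiouville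

section CaccioppoliBall

variable {c : ℝ} {a b : E3} {w : ℤ → E3}

/-! ### UZ.1  Index balls as finsets; the near set of a ball -/

/-- the index ball as a finset. [this file, g57] -/
def idxBallF (x₀ : Cell 2 × ℤ) (n : ℝ) : Finset (Cell 2 × ℤ) :=
  ((isCompact_closedBall x₀ n).finite_of_discrete).toFinset

/-- Auxiliary step (`mem idxBallF`). [formal bookkeeping] -/
theorem mem_idxBallF {x₀ X : Cell 2 × ℤ} {n : ℝ} : X ∈ idxBallF x₀ n ↔ dist X x₀ ≤ n := by
  unfold idxBallF
  rw [Set.Finite.mem_toFinset, mem_closedBall]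

/-- Auxiliary step (`coe idxBallF`). [formal bookkeeping] -/
theorem coe_idxBallF (x₀ : Cell 2 × ℤ) (n : ℝ) : (↑(idxBallF x₀ n) : Set (Cell 2 × ℤ)) = idxBall x₀ n := by
  ext X
  rw [Finset.mem_coe, mem_idxBallF]
  rfl

/-- the `ϱ`-near set of an index ball lies in the index ball enlarged by `ϱ / c` (co-Lipschitz). [this file, g57] -/
theorem nearSet_idxBallF_subset (hc : 0 < c) (hL : IsLayeredCrystal c a b w) {ϱ : ℝ} (x₀ : Cell 2 × ℤ) (n : ℝ) :
    nearSet hc hL ϱ (idxBallF x₀ n) ⊆ idxBallF x₀ (n + ϱ / c) := by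
  intro Y hY
  unfold nearSet at hY
  obtain ⟨X, hX, hYX⟩ := Finset.mem_biUnion.mp hY
  rw [Set.Finite.mem_toFinset, Set.mem_setOf_eq] at hYX
  rw [mem_idxBallF] at hX ⊢
  have hd : dist Y X ≤ ϱ / c := by
    rw [le_div_iff₀ hc, mul_comm]
    exact (hL Y X).trans hYX
  calc dist Y x₀ ≤ dist Y X + dist X x₀ := dist_triangle _ _ _
    _ ≤ ϱ / c + n := add_le_add hd hX
    _ = n + ϱ / c := add_comm _ _

/-! ### UZ.2  The radial cut-off -/

/-- the piecewise-linear radial cut-off between the index balls of radii `r < n`. [this file, g57] -/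
def radialCut (x₀ : Cell 2 × ℤ) (r n : ℝ) (X : Cell 2 × ℤ) : ℝ :=
  max 0 (min 1 ((n - dist X x₀) / (n - r)))

/-- Auxiliary step (`radialCut eq one`). [formal bookkeeping] -/
theorem radialCut_eq_one {x₀ X : Cell 2 × ℤ} {r n : ℝ} (hrn : r < n) (hX : dist X x₀ ≤ r) : radialCut x₀ r n X = 1 := by
  unfold radialCut
  have h1 : 1 ≤ (n - dist X x₀) / (n - r) := by
    rw [le_div_iff₀ (sub_pos.mpr hrn), one_mul]
    linarith
  rw [min_eq_left h1, max_eq_right zero_le_one]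

/-- Auxiliary step (`radialCut eq zero`). [formal bookkeeping] -/
theorem radialCut_eq_zero {x₀ X : Cell 2 × ℤ} {r n : ℝ} (hrn : r < n) (hX : n < dist X x₀) : radialCut x₀ r n X = 0 := by
  unfold radialCut
  have h1 : (n - dist X x₀) / (n - r) < 0 := div_neg_of_neg_of_pos (by linarith) (sub_pos.mpr hrn)
  rw [min_eq_right (h1.le.trans zero_le_one), max_eq_left h1.le]

/-- Auxiliary step (`radialCut eq zero of not mem`). [formal bookkeeping] -/
theorem radialCut_eq_zero_of_not_mem {x₀ X : Cell 2 × ℤ} {r n : ℝ} (hrn : r < n) (hX : X ∉ idxBallF x₀ n) :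
    radialCut x₀ r n X = 0 :=
  radialCut_eq_zero hrn (not_le.mp fun h => hX (mem_idxBallF.mpr h))

/-- the radial cut-off is `(n − r)⁻¹`-Lipschitz for the index metric. [this file, g57] -/
theorem abs_radialCut_sub_le {x₀ : Cell 2 × ℤ} {r n : ℝ} (hrn : r < n) (X Y : Cell 2 × ℤ) :
    |radialCut x₀ r n Y - radialCut x₀ r n X| ≤ (n - r)⁻¹ * dist X Y := by
  unfold radialCut
  have hnr : 0 < n - r := sub_pos.mpr hrn
  calc |max 0 (min 1 ((n - dist Y x₀) / (n - r))) - max 0 (min 1 ((n - dist X x₀) / (n - r)))|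
      ≤ |min 1 ((n - dist Y x₀) / (n - r)) - min 1 ((n - dist X x₀) / (n - r))| := by
        rw [max_comm 0, max_comm 0]
        exact abs_max_sub_max_le_abs _ _ _
    _ ≤ max |(1 : ℝ) - 1| |(n - dist Y x₀) / (n - r) - (n - dist X x₀) / (n - r)| := abs_min_sub_min_le_max _ _ _ _
    _ = |(n - dist Y x₀) / (n - r) - (n - dist X x₀) / (n - r)| := by
        rw [sub_self, abs_zero, max_eq_right (abs_nonneg _)]
    _ = |dist X x₀ - dist Y x₀| / (n - r) := by
        rw [← sub_div, abs_div, abs_of_pos hnr]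
        congr 1
        ring_nf
    _ ≤ dist X Y / (n - r) := div_le_div_of_nonneg_right (abs_dist_sub_le X Y x₀) hnr.le
    _ = (n - r)⁻¹ * dist X Y := by rw [div_eq_inv_mul]

/-! ### UZ.3  The localised energy of the cut field -/

/-- on the inner ball the cut field `ζ • (φ − v)` has the increments of `φ`. [this file, g57] -/
theorem idxEnergy_cutField_eq {x₀ : Cell 2 × ℤ} {r n : ℝ} (hrn : r < n) (φ : Cell 2 → ℤ → E3) (v : E3) :
    idxEnergy (cutField (radialCut x₀ r n) (fun γ α => φ γ α - v)) (idxBall x₀ r) = idxEnergy φ (idxBall x₀ r) := by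
  unfold idxEnergy
  refine finsum_mem_congr rfl fun x hx => ?_
  have h1 : radialCut x₀ r n x.1 = 1 := radialCut_eq_one hrn hx.1
  have h2 : radialCut x₀ r n x.2 = 1 := radialCut_eq_one hrn hx.2.1
  rw [cutField_apply, cutField_apply, h1, h2, one_smul, one_smul, sub_sub_sub_cancel_right]

/-! ### UZ.4  ★ Caccioppoli on index balls -/

/-- ★★ **CACCIOPPOLI ON INDEX BALLS** ([giaquinta1984 Ch. III (2.2)], lattice form, global stability only):
`κ₀ · idxEnergy φ (idxBall x₀ r) ≤ 54·F(c)·(n − r)⁻² · Σ_{X ∈ idxBall x₀ (n + ϱ/c)} ‖φ_X − v‖²` for `φ` `ϱ`-truncated-harmonic on `idxBall x₀ n`,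
`r < n`, `v` free, `ϱ ≥ ϱ_C(c, κ₀)`, uniformly over `κ₀`-coercive `c`-co-Lipschitz layered crystals. [this file, g57] -/
theorem caccioppoli_idxBall (hc : 0 < c) {κ₀ : ℝ} (hκ₀ : 0 < κ₀) :
    ∃ ϱC : ℝ, 1 ≤ ϱC ∧ ∀ ϱ : ℝ, ϱC ≤ ϱ → ∀ (a b : E3) (w : ℤ → E3), IsLayeredCrystal c a b w → CoerciveZ (layeredKernel a b w) κ₀ →
      ∀ (x₀ : Cell 2 × ℤ) (r n : ℝ), r < n → ∀ φ : Cell 2 → ℤ → E3, IsTruncHarmonicZ ϱ a b w φ (idxBall x₀ n) → ∀ v : E3,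
        κ₀ * idxEnergy φ (idxBall x₀ r) ≤
          54 * kernelConst c * ((n - r)⁻¹) ^ 2 * ∑ X ∈ idxBallF x₀ (n + ϱ / c), ‖φ X.1 X.2 - v‖ ^ 2 := by
  obtain ⟨ϱC, hϱC, h⟩ := caccioppoliZ_cert (c := c) hc hκ₀
  refine ⟨ϱC, hϱC, fun ϱ hϱ a b w hL hK x₀ r n hrn φ hφ v => ?_⟩
  have hφ' : IsTruncHarmonicZ ϱ a b w φ ↑(idxBallF x₀ n) := by rwa [coe_idxBallF]
  have hmain := h ϱ hϱ a b w hL hK (idxBallF x₀ n) φ hφ' (radialCut x₀ r n) ((n - r)⁻¹)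
    (fun X hX => radialCut_eq_zero_of_not_mem hrn hX) (abs_radialCut_sub_le hrn) v
  have hζP := cutField_eq_zero (fun X hX => radialCut_eq_zero_of_not_mem (x₀ := x₀) hrn hX) (fun γ α => φ γ α - v)
  have hE : idxEnergy φ (idxBall x₀ r) ≤ nnFormZ (cutField (radialCut x₀ r n) (fun γ α => φ γ α - v)) := by
    rw [← idxEnergy_cutField_eq hrn φ v]
    exact idxEnergy_le_nnFormZ hζP _
  have hsum : ∑ X ∈ nearSet hc hL ϱ (idxBallF x₀ n), ‖φ X.1 X.2 - v‖ ^ 2 ≤ ∑ X ∈ idxBallF x₀ (n + ϱ / c), ‖φ X.1 X.2 - v‖ ^ 2 :=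
    Finset.sum_le_sum_of_subset_of_nonneg (nearSet_idxBallF_subset hc hL x₀ n) fun X _ _ => sq_nonneg _
  have hF : 0 ≤ 54 * kernelConst c * ((n - r)⁻¹) ^ 2 := by
    have := kernelConst_nonneg hc; positivity
  calc κ₀ * idxEnergy φ (idxBall x₀ r) ≤ κ₀ * nnFormZ (cutField (radialCut x₀ r n) (fun γ α => φ γ α - v)) :=
        mul_le_mul_of_nonneg_left hE hκ₀.le
    _ ≤ 54 * kernelConst c * ((n - r)⁻¹) ^ 2 * ∑ X ∈ nearSet hc hL ϱ (idxBallF x₀ n), ‖φ X.1 X.2 - v‖ ^ 2 := hmain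
    _ ≤ 54 * kernelConst c * ((n - r)⁻¹) ^ 2 * ∑ X ∈ idxBallF x₀ (n + ϱ / c), ‖φ X.1 X.2 - v‖ ^ 2 :=
        mul_le_mul_of_nonneg_left hsum hF

end CaccioppoliBall

end Summit.AtomisticToContinuum.Crystallization.Theorems.ChartedZeroExcessLayeredLatticeLiouville

end
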